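import Summits.QuantumFields.YangMills.Theorems.ConvexGribovBodyCovarianceBoundDefsB
import Literature.MathematicalPhysics.QuantumLattice.RepLieAlgebra
import Literature.Analysis.Calculus.ClosedSubgroupExpChart
import HarnessLib

/-!
# Stub `stub_lieAlgPerfect` (F1) for the crux `CovarianceBound` (stmt-QuantumFields-8780), line `Sketch`

Route `QuantumFields/YangMills/ConvexGribovBody`, crux
`Summit.QuantumFields.YangMills.Theses.ConvexGribovBody.CovarianceBound`, skeleton line `Sketch` (v5).
This file proves the registered Lie-theoretic stub `stub_lieAlgPerfect`: for a compact simple linear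
group `G` (`IsCompactSimpleLieGroup G`) and any faithful unitary representation `r : LatticeRep G`,
the embedded Lie algebra `𝔤 = r.lieAlg ⊆ 𝔲(N)` is **perfect** — the real span of the commutators
`XY − YX` of one-parameter generators is all of `𝔤` (`LieAlgPerfect r`, vocabulary file
`…CovarianceBoundDefsB.lean`).

Proof (Sepanski, *Compact Lie Groups*, Thm. 5.18; Hall, GTM 222, Thm. 3.20; von Neumann 1929):
* `r.lieAlg` is the tree's `repLieAlgebra r` (closed-subgroup theorem, `RepLieAlgebra.lean`), so it
  is closed under brackets and equal to its defining set;
* the Hilbert–Schmidt form `⟨X, Y⟩ = Re tr(X Yᴴ)` is positive definite and `ad`-invariant on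
  skew-Hermitian matrices, `⟨[Z,X], W⟩ = ⟨Z, [X,W]⟩`; hence an element `Z ∈ 𝔤` orthogonal to all
  commutators satisfies `‖[Z,X]‖² = ⟨Z, [X,[Z,X]]⟩ = 0`, i.e. `Z` is central in `𝔤`;
* `exp` of the generators fills a neighbourhood of `1` in `ρ(G)` (exponential chart,
  `ClosedSubgroupExpChart.lean`), and an open subgroup of the connected `G` is everything, so `Z`
  commutes with `ρ(G)`: `exp(ℝZ)` pulls back to a central one-parameter subgroup of `G`, whose
  closure is a closed connected normal subgroup; by simplicity it is trivial (then `Z = 0`, the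
  generator of a one-parameter group being unique) or all of `G` (then `G` is abelian — excluded);
* with `D` the commutator span, `M_N(ℂ) = D ⊕ D^⊥` decomposes `Z ∈ 𝔤` as `d + e` with
  `e ∈ 𝔤 ∩ D^⊥` central, hence `e = 0` and `Z = d ∈ D`.

Helper lemmas live in the sub-namespace `LiePerfect`. No named facts are used.
-/

set_option autoImplicit false

noncomputable section

namespace Summit.QuantumFields.YangMills.Cruxes.CovarianceBound.SupportWindow

open scoped Matrix Topology
open Set NormedSpace
open Literature.MathematicalPhysics.QuantumFieldTheory Literature.MathematicalPhysics.QuantumLattice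

/-! ### Helper lemmas (sub-namespace `LiePerfect`) -/

namespace LiePerfect

section Matrices

variable {N : ℕ}

/-- **`ad`-invariance of the Hilbert–Schmidt form**: `⟨ZX − XZ, W⟩ = ⟨Z, XW − WX⟩` for
skew-Hermitian `X` (cyclicity of the trace). [cite: Sepanski2007, Thm. 5.18] -/
theorem hsForm_bracket_left (Z X W : Matrix (Fin N) (Fin N) ℂ) (hX : star X = -X) :
    hsForm N (Z * X - X * Z) W = hsForm N Z (X * W - W * X) := by
  have hX' : Xᴴ = -X := hX
  have h1 : (X * (Z * Wᴴ)).trace = (Z * (Wᴴ * X)).trace := by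
    rw [Matrix.trace_mul_comm, Matrix.mul_assoc]
  simp only [hsForm_apply, Matrix.conjTranspose_sub, Matrix.conjTranspose_mul, hX', Matrix.mul_neg,
    Matrix.neg_mul, Matrix.sub_mul, Matrix.mul_sub, Matrix.trace_sub, Matrix.trace_neg,
    Complex.sub_re, Complex.neg_re, Matrix.mul_assoc]
  rw [h1]
  ring

set_option backward.isDefEq.respectTransparency false in
open scoped Matrix.Norms.Operator in
/-- `t ↦ exp(tZ)` is continuous. [folklore] -/
theorem continuous_exp_smul (Z : Matrix (Fin N) (Fin N) ℂ) :
    Continuous fun t : ℝ => exp (t • Z) :=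
  continuous_iff_continuousAt.2 fun t => (hasDerivAt_exp_smul_const' (𝕂 := ℝ) Z t).continuousAt

/-- `exp(sZ) exp(tZ) = exp((s + t)Z)`. [folklore] -/
theorem exp_smul_mul_exp_smul (Z : Matrix (Fin N) (Fin N) ℂ) (s t : ℝ) :
    exp (s • Z) * exp (t • Z) = exp ((s + t) • Z) := by
  rw [add_smul, Matrix.exp_add_of_commute _ _ (((Commute.refl Z).smul_left s).smul_right t)]

end Matrices

variable {G : Type} [Group G] [TopologicalSpace G]

section Compact

variable [CompactSpace G]

/-- The defining set of `𝔤` IS the tree's `repLieAlgebra r` (closed-subgroup theorem; skew-Hermitian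
is automatic inside `U(N)`). [cite: Hall2015, Theorem 3.20] -/
theorem lieAlgCarrier_eq_coe (r : LatticeRep G) :
    r.lieAlgCarrier = (repLieAlgebra r : Set (Matrix (Fin r.N) (Fin r.N) ℂ)) := by
  ext X
  rw [SetLike.mem_coe, repLieAlgebra_def,
    mem_matrixLieAlgebra_iff r.one_mem_range r.mul_mem_range r.isClosed_range]
  exact ⟨fun h => h.2,
    fun h => ⟨star_eq_neg_of_mem_oneParamGenerators r.range_subset_unitaryGroup h, h⟩⟩

/-- `r.lieAlg = repLieAlgebra r`. [cite: Hall2015, Theorem 3.20] -/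
theorem lieAlg_eq (r : LatticeRep G) : r.lieAlg = repLieAlgebra r := by
  rw [LatticeRep.lieAlg, lieAlgCarrier_eq_coe, Submodule.span_eq]

/-- Membership in `𝔤` is membership in its defining set. [cite: Hall2015, Theorem 3.20] -/
theorem mem_lieAlg_iff (r : LatticeRep G) {X : Matrix (Fin r.N) (Fin r.N) ℂ} :
    X ∈ r.lieAlg ↔ X ∈ r.lieAlgCarrier := by
  rw [← SetLike.mem_coe, lieAlg_eq, lieAlgCarrier_eq_coe]

/-- `𝔤` is closed under the commutator. [cite: Hall2015, Theorem 3.20 (4)] -/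
theorem bracket_mem (r : LatticeRep G) {X Y : Matrix (Fin r.N) (Fin r.N) ℂ}
    (hX : X ∈ r.lieAlgCarrier) (hY : Y ∈ r.lieAlgCarrier) : X * Y - Y * X ∈ r.lieAlgCarrier := by
  rw [lieAlgCarrier_eq_coe] at hX hY ⊢
  exact mul_sub_mul_mem_repLieAlgebra r hX hY

/-- The commutator span lies in `𝔤`. [cite: Hall2015, Theorem 3.20 (4)] -/
theorem span_bracket_le (r : LatticeRep G) :
    Submodule.span ℝ {Z | ∃ X ∈ r.lieAlgCarrier, ∃ Y ∈ r.lieAlgCarrier, Z = X * Y - Y * X} ≤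
      r.lieAlg := by
  refine Submodule.span_le.2 ?_
  rintro _ ⟨X, hX, Y, hY, rfl⟩
  exact r.lieAlgCarrier_subset_lieAlg (bracket_mem r hX hY)

/-- **The orthogonal complement of the commutators is central in `𝔤`**: if `Z ∈ 𝔤` is
Hilbert–Schmidt-orthogonal to every `XY − YX` (`X, Y ∈ 𝔤`) then `‖ZX − XZ‖² = ⟨Z, [X, ZX − XZ]⟩ = 0`.
[cite: Sepanski2007, Thm. 5.18] -/
theorem commute_of_orthogonal (r : LatticeRep G) {Z : Matrix (Fin r.N) (Fin r.N) ℂ}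
    (hZ : Z ∈ r.lieAlgCarrier)
    (horth : ∀ X ∈ r.lieAlgCarrier, ∀ Y ∈ r.lieAlgCarrier, hsForm r.N Z (X * Y - Y * X) = 0)
    {X : Matrix (Fin r.N) (Fin r.N) ℂ} (hX : X ∈ r.lieAlgCarrier) : Commute Z X := by
  have hW : Z * X - X * Z ∈ r.lieAlgCarrier := bracket_mem r hZ hX
  have h0 : hsForm r.N (Z * X - X * Z) (Z * X - X * Z) = 0 := by
    rw [hsForm_bracket_left Z X _ hX.1]
    exact horth X hX _ hW
  exact sub_eq_zero.1 (hsForm_self_eq_zero.1 h0)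

variable [IsTopologicalGroup G]

set_option backward.isDefEq.respectTransparency false in
open scoped Matrix.Norms.Frobenius in
/-- **A matrix commuting with `𝔤` commutes with `ρ(G)`** (`G` connected): the commutant of `Z` in
`G` is a subgroup containing the exponential chart neighbourhood of `1` (every `ρ(g)` near `1` is
`exp X` with `X ∈ 𝔤`, von Neumann), hence open, hence closed, hence everything.
[cite: vonNeumann1929, §3] -/
theorem commute_rho_of_commute_lieAlg [ConnectedSpace G] (r : LatticeRep G)
    {Z : Matrix (Fin r.N) (Fin r.N) ℂ} (hcomm : ∀ X ∈ r.lieAlgCarrier, Commute Z X) (g : G) :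
    Commute Z (r.ρ g) := by
  -- the commutant of `Z` as a subgroup of `G`
  obtain ⟨T, hT⟩ : ∃ T : Subgroup G, ∀ a, a ∈ T ↔ Commute Z (r.ρ a) :=
    ⟨{ carrier := {a | Commute Z (r.ρ a)}
       one_mem' := by simp only [mem_setOf_eq, map_one]; exact Commute.one_right Z
       mul_mem' := fun {a b} ha hb => by
         simp only [mem_setOf_eq, map_mul] at ha hb ⊢; exact ha.mul_right hb
       inv_mem' := fun {a} ha => by
         simp only [mem_setOf_eq] at ha ⊢
         have h1 : r.ρ a⁻¹ * r.ρ a = 1 := by rw [← map_mul, inv_mul_cancel, map_one]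
         have h2 : r.ρ a * r.ρ a⁻¹ = 1 := by rw [← map_mul, mul_inv_cancel, map_one]
         calc Z * r.ρ a⁻¹ = r.ρ a⁻¹ * r.ρ a * Z * r.ρ a⁻¹ := by rw [h1, one_mul]
           _ = r.ρ a⁻¹ * (Z * r.ρ a) * r.ρ a⁻¹ := by rw [mul_assoc (r.ρ a⁻¹), ha.eq]
           _ = r.ρ a⁻¹ * Z := by rw [← mul_assoc, mul_assoc, h2, mul_one] }, fun a => Iff.rfl⟩
  -- it contains the exponential chart neighbourhood of `1`
  obtain ⟨ε, hε, hchart⟩ := Literature.Analysis.Calculus.exists_exp_chart_range r.ρ r.continuous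
  have hnhds : (T : Set G) ∈ 𝓝 (1 : G) := by
    have hfc : Continuous fun A : Matrix (Fin r.N) (Fin r.N) ℂ => frobNorm A := by
      unfold frobNorm; fun_prop
    have hopen : IsOpen {a : G | frobNorm (r.ρ a - 1) < ε} :=
      isOpen_lt (hfc.comp (r.continuous.sub continuous_const)) continuous_const
    refine Filter.mem_of_superset (hopen.mem_nhds ?_) fun a ha => ?_
    · show frobNorm (r.ρ 1 - 1) < ε
      simpa [frobNorm] using hε
    · obtain ⟨X, hX, hXg, -⟩ := hchart a (by rw [← frobNorm_eq_norm]; exact ha)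
      have hXc : X ∈ r.lieAlgCarrier := by
        rw [lieAlgCarrier_eq_coe, SetLike.mem_coe, repLieAlgebra_def,
          mem_matrixLieAlgebra_iff r.one_mem_range r.mul_mem_range r.isClosed_range]
        intro t
        obtain ⟨k, hk⟩ := hX t
        exact ⟨k, hk⟩
      refine (hT a).2 ?_
      rw [← hXg]
      exact (hcomm X hXc).exp_right
  have hopenT : IsOpen (T : Set G) := T.isOpen_of_mem_nhds hnhds
  have huniv : (T : Set G) = univ :=
    IsClopen.eq_univ ⟨T.isClosed_of_isOpen hopenT, hopenT⟩ ⟨1, T.one_mem⟩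
  exact (hT g).1 (show g ∈ (T : Set G) from huniv ▸ mem_univ g)

/-- **A central one-parameter generator of a compact simple group vanishes.** If `Z ∈ 𝔤` commutes
with `𝔤` then `exp(ℝZ) ⊆ ρ(G)` pulls back to a central one-parameter subgroup of `G`; its closure is
a closed connected normal subgroup, so by simplicity it is trivial — whence `exp(tZ) = 1` for all `t`
and `Z = 0` — or all of `G`, which would make `G` abelian.
[cite: Sepanski2007, Thm. 5.18 and Thm. 5.21–5.22] -/
theorem eq_zero_of_commute_lieAlg (hG : IsSimpleCompactGroup G) (r : LatticeRep G)
    {Z : Matrix (Fin r.N) (Fin r.N) ℂ} (hZ : Z ∈ r.lieAlgCarrier)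
    (hcomm : ∀ X ∈ r.lieAlgCarrier, Commute Z X) : Z = 0 := by
  haveI : ConnectedSpace G := hG.1
  have hρ : ∀ g, Commute Z (r.ρ g) := commute_rho_of_commute_lieAlg r hcomm
  -- the one-parameter subgroup `ρ⁻¹(exp ℝZ)`
  obtain ⟨S, hS⟩ : ∃ S : Subgroup G, ∀ g, g ∈ S ↔ ∃ t : ℝ, r.ρ g = exp (t • Z) :=
    ⟨{ carrier := {g | ∃ t : ℝ, r.ρ g = exp (t • Z)}
       one_mem' := ⟨0, by rw [map_one, zero_smul, exp_zero]⟩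
       mul_mem' := fun {a b} ha hb => by
         obtain ⟨s, hs⟩ := ha
         obtain ⟨t, ht⟩ := hb
         exact ⟨s + t, by rw [map_mul, hs, ht, exp_smul_mul_exp_smul]⟩
       inv_mem' := fun {a} ha => by
         obtain ⟨t, ht⟩ := ha
         refine ⟨-t, ?_⟩
         have h1 : r.ρ a⁻¹ * r.ρ a = 1 := by rw [← map_mul, inv_mul_cancel, map_one]
         have h2 : exp (t • Z) * exp ((-t) • Z) = 1 := by
           rw [exp_smul_mul_exp_smul, add_neg_cancel, zero_smul, exp_zero]
         calc r.ρ a⁻¹ = r.ρ a⁻¹ * (r.ρ a * exp ((-t) • Z)) := by rw [ht, h2, mul_one]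
           _ = exp ((-t) • Z) := by rw [← mul_assoc, h1, one_mul] }, fun g => Iff.rfl⟩
  -- `S` is central, hence normal, and so is its closure `N`
  have hcen : ∀ g ∈ S, ∀ h : G, h * g = g * h := by
    intro g hg h
    obtain ⟨t, ht⟩ := (hS g).1 hg
    apply r.injective
    rw [map_mul, map_mul, ht]
    exact (((hρ h).smul_left t).exp_left).eq.symm
  haveI hSn : S.Normal := ⟨fun n hn g => by rw [hcen n hn g, mul_inv_cancel_right]; exact hn⟩
  haveI hNn : S.topologicalClosure.Normal := Subgroup.is_normal_topologicalClosure S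
  -- `S`, the homeomorphic pull-back of the connected `exp(ℝZ)`, and its closure are connected
  have hemb : Topology.IsClosedEmbedding r.ρ := r.continuous.isClosedEmbedding r.injective
  have hSimg : r.ρ '' (S : Set G) = range fun t : ℝ => exp (t • Z) := by
    ext M
    constructor
    · rintro ⟨g, hg, rfl⟩
      obtain ⟨t, ht⟩ := (hS g).1 hg
      exact ⟨t, ht.symm⟩
    · rintro ⟨t, rfl⟩
      obtain ⟨k, hk⟩ := hZ.2 t
      exact ⟨k, (hS k).2 ⟨t, hk⟩, hk⟩
  have hNpc : IsPreconnected (S.topologicalClosure : Set G) := by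
    rw [Subgroup.topologicalClosure_coe]
    refine IsPreconnected.closure ?_
    rw [← hemb.isInducing.isPreconnected_image, hSimg]
    exact isPreconnected_range (continuous_exp_smul Z)
  -- simplicity: the closure is trivial or everything
  rcases hG.2.2 S.topologicalClosure hNn (Subgroup.isClosed_topologicalClosure S) hNpc with
    hbot | htop
  · refine eq_of_forall_exp_smul_eq fun t => ?_
    obtain ⟨k, hk⟩ := hZ.2 t
    have hkN : k ∈ S.topologicalClosure := S.le_topologicalClosure ((hS k).2 ⟨t, hk⟩)
    rw [hbot, Subgroup.mem_bot] at hkN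
    rw [← hk, hkN, map_one, smul_zero, exp_zero]
  · exfalso
    obtain ⟨a, b, hab⟩ := hG.2.1
    haveI : T2Space G := hemb.isEmbedding.t2Space
    have hcl : IsClosed {g : G | b * g = g * b} :=
      isClosed_eq (continuous_const.mul continuous_id) (continuous_id.mul continuous_const)
    have haN : a ∈ (S.topologicalClosure : Set G) := by rw [htop]; trivial
    rw [Subgroup.topologicalClosure_coe] at haN
    exact hab ((hcl.closure_subset_iff.2 fun g hg => hcen g hg b) haN).symm

end Compact

end LiePerfect

/-! ### The stub -/

open LiePerfect in
/-- **Stub `stub_lieAlgPerfect` (F1): `𝔤` is perfect for a compact simple `G`.** The real span of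
the commutators `XY − YX` of one-parameter generators of `ρ(G)` is the whole embedded Lie algebra
`𝔤 = r.lieAlg`: `⊆` is bracket-closure of `𝔤` (Hall, Thm. 3.20); for `⊇`, decompose `Z ∈ 𝔤` along
`M_N(ℂ) = D ⊕ D^⊥` (`D` the commutator span, `Re tr(X Yᴴ)` positive definite): the `D^⊥`-component
lies in `𝔤`, is central in `𝔤` by `ad`-invariance, hence generates a central one-parameter subgroup
of the connected group `G`, which simplicity forces to be trivial (Sepanski, Thm. 5.18: a compact
Lie algebra with trivial centre is semisimple, `[𝔤, 𝔤] = 𝔤`).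
[cite: Sepanski2007, Thm. 5.18 and Thm. 5.21–5.22] [cite: Hall2015, Theorem 3.20] -/
theorem stub_lieAlgPerfect :
    ∀ (G : Type) [Group G] [TopologicalSpace G] [IsTopologicalGroup G] [CompactSpace G],
      IsCompactSimpleLieGroup G → ∀ r : LatticeRep G, LieAlgPerfect r := by
  intro G _ _ _ _ hG r
  refine le_antisymm (span_bracket_le r) fun Z hZ => ?_
  set D : Submodule ℝ (Matrix (Fin r.N) (Fin r.N) ℂ) :=
    Submodule.span ℝ {Z | ∃ X ∈ r.lieAlgCarrier, ∃ Y ∈ r.lieAlgCarrier, Z = X * Y - Y * X} with hD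
  have hc : IsCompl D ((hsForm r.N).orthogonal D) :=
    (hsForm r.N).isCompl_orthogonal_of_restrict_nondegenerate hsForm_isRefl
      (hsForm_restrict_nondegenerate D)
  have hZ' : Z ∈ D ⊔ (hsForm r.N).orthogonal D := by rw [hc.sup_eq_top]; trivial
  obtain ⟨d, hd, e, he, hde⟩ := Submodule.mem_sup.1 hZ'
  have heA : e ∈ r.lieAlgCarrier := by
    rw [← mem_lieAlg_iff]
    have : e = Z - d := by rw [← hde]; abel
    rw [this]
    exact Submodule.sub_mem _ hZ (span_bracket_le r hd)
  have horth : ∀ X ∈ r.lieAlgCarrier, ∀ Y ∈ r.lieAlgCarrier, hsForm r.N e (X * Y - Y * X) = 0 :=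
    fun X hX Y hY => by
      rw [hsForm_comm]
      exact (LinearMap.BilinForm.mem_orthogonal_iff.1 he) _ (Submodule.subset_span ⟨X, hX, Y, hY, rfl⟩)
  have he0 : e = 0 :=
    eq_zero_of_commute_lieAlg hG.1 r heA fun X hX => commute_of_orthogonal r heA horth hX
  rw [← hde, he0, add_zero]
  exact hd

end Summit.QuantumFields.YangMills.Cruxes.CovarianceBound.SupportWindow

end
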